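import Mathlib
import Summits.Ventures.PercRepro.TriangleCapThreeTrianglesA
import Summits.Ventures.PercRepro.TriangleCapTwoTrianglesEightD

/-!
# PercRepro — THREE VERTEX-DISJOINT TRIANGLES PAY THE `r = 2` CELL FOR EVERY `k ≥ 10` (p3, gen 37; part 62)

`S = T₁ ∪ T₂ ∪ T₃`, three pairwise disjoint three-cliques, every vertex off `Tᵢ` with at most one neighbour in
`Tᵢ`: `2 ≤ degIn S x ≤ 4` on `S` (so `18 ≤ Q ≤ 36`), `degIn S z ≤ 3` and `W(z) ≤ 4 degIn S z` off `S`; the far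
count of TriangleCapThreeTrianglesA gives `Σ_p deficit(p) ≥ 180 − 4Q + |Sᶜ| (Q − 12) ≥ 4k + 6` for `k ≥ 10`.
With at most `18` ordered triangles when every triangle is one of `T₁, T₂, T₃`
(`card_triangles3_le_eighteen_of_three`) this is the `r = 2` stability for three vertex-disjoint triangles:
**`three_triangles_stability_two_of_disjoint`** (`k ≥ 10`).
Axioms: standard.
-/

namespace PercRepro

namespace TriangleCap

namespace C047

open Finset

variable {V : Type*} [Fintype V] [DecidableEq V]

omit [Fintype V] [DecidableEq V] in
/-- `W(z) ≤ 4 degIn S z` when every vertex of `S` has at most four neighbours in `S`. -/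
theorem sum_degIn_le_four_mul (D : SimpleGraph V) [DecidableRel D.Adj] (S : Finset V)
    (h4 : ∀ x ∈ S, degIn D S x ≤ 4) (z : V) :
    ∑ x ∈ S.filter (fun x => D.Adj z x), degIn D S x ≤ 4 * degIn D S z := by
  calc ∑ x ∈ S.filter (fun x => D.Adj z x), degIn D S x ≤ ∑ x ∈ S.filter (fun x => D.Adj z x), 4 :=
        sum_le_sum (fun x hx => h4 x (mem_filter.mp hx).1)
    _ = 4 * degIn D S z := by rw [sum_const, smul_eq_mul, mul_comm]; rfl

/-- **THE FAR COUNT FOR THREE VERTEX-DISJOINT TRIANGLES:** `4k + 6 ≤ Σ_p deficit(p)` for `k ≥ 10`. -/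
theorem four_mul_card_add_six_le_sum_deficit_of_three_disjoint (D : SimpleGraph V) [DecidableRel D.Adj]
    (T₁ T₂ T₃ : Finset V) (h₁ : T₁.card = 3) (h₂ : T₂.card = 3) (h₃ : T₃.card = 3)
    (h12 : Disjoint T₁ T₂) (h13 : Disjoint T₁ T₃) (h23 : Disjoint T₂ T₃)
    (hcl₁ : ∀ x ∈ T₁, ∀ y ∈ T₁, x ≠ y → D.Adj x y) (hcl₂ : ∀ x ∈ T₂, ∀ y ∈ T₂, x ≠ y → D.Adj x y)
    (hcl₃ : ∀ x ∈ T₃, ∀ y ∈ T₃, x ≠ y → D.Adj x y)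
    (hone₁ : ∀ z, z ∉ T₁ → degIn D T₁ z ≤ 1) (hone₂ : ∀ z, z ∉ T₂ → degIn D T₂ z ≤ 1)
    (hone₃ : ∀ z, z ∉ T₃ → degIn D T₃ z ≤ 1) (hk : 10 ≤ Fintype.card V) :
    4 * Fintype.card V + 6 ≤ ∑ p ∈ adjPairsAll D, deficit D p := by
  have hi12 : (T₁ ∩ T₂).card ≤ 1 := by rw [disjoint_iff_inter_eq_empty.mp h12, card_empty]; exact Nat.zero_le _
  have hi13 : (T₁ ∩ T₃).card ≤ 1 := by rw [disjoint_iff_inter_eq_empty.mp h13, card_empty]; exact Nat.zero_le _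
  have hi23 : (T₂ ∩ T₃).card ≤ 1 := by rw [disjoint_iff_inter_eq_empty.mp h23, card_empty]; exact Nat.zero_le _
  have hcount := three_triangles_far_count D T₁ T₂ T₃ h₁ h₂ h₃ hi12 hi13 hi23 hcl₁ hcl₂ hcl₃
  set S := T₁ ∪ T₂ ∪ T₃ with hS
  have hd12 : Disjoint (T₁ ∪ T₂) T₃ := disjoint_union_left.mpr ⟨h13, h23⟩
  have hScard : S.card = 9 := by
    rw [hS, card_union_of_disjoint hd12, card_union_of_disjoint h12, h₁, h₂, h₃]
  have hRcard : Sᶜ.card + 9 = Fintype.card V := by rw [card_compl, hScard]; omega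
  -- the degrees into `S`
  have hsplit : ∀ x, degIn D S x ≤ degIn D T₁ x + degIn D T₂ x + degIn D T₃ x := by
    intro x
    rw [hS]
    have h1 := degIn_union_le D (T₁ ∪ T₂) T₃ x
    have h2 := degIn_union_le D T₁ T₂ x
    omega
  have hdeg4 : ∀ x ∈ S, degIn D S x ≤ 4 := by
    intro x hx
    rw [hS, mem_union, mem_union] at hx
    have h := hsplit x
    rcases hx with (hx | hx) | hx
    · have := degIn_le_two_of_mem D h₁ hx
      have := hone₂ x (fun h' => disjoint_left.mp h12 hx h')
      have := hone₃ x (fun h' => disjoint_left.mp h13 hx h')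
      omega
    · have := degIn_le_two_of_mem D h₂ hx
      have := hone₁ x (fun h' => disjoint_left.mp h12 h' hx)
      have := hone₃ x (fun h' => disjoint_left.mp h23 hx h')
      omega
    · have := degIn_le_two_of_mem D h₃ hx
      have := hone₁ x (fun h' => disjoint_left.mp h13 h' hx)
      have := hone₂ x (fun h' => disjoint_left.mp h23 h' hx)
      omega
  have hdeg2 : ∀ x ∈ S, 2 ≤ degIn D S x := by
    intro x hx
    rw [hS, mem_union, mem_union] at hx
    rw [hS]
    rcases hx with (hx | hx) | hx
    · have h1 := degIn_left_le_union D (T₁ ∪ T₂) T₃ x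
      have h2 := degIn_left_le_union D T₁ T₂ x
      rw [degIn_self_of_clique D h₁ hcl₁ hx] at h2
      omega
    · have h1 := degIn_left_le_union D (T₁ ∪ T₂) T₃ x
      have h2 := degIn_right_le_union D T₁ T₂ x
      rw [degIn_self_of_clique D h₂ hcl₂ hx] at h2
      omega
    · have h1 := degIn_right_le_union D (T₁ ∪ T₂) T₃ x
      rw [degIn_self_of_clique D h₃ hcl₃ hx] at h1
      exact h1
  have hout : ∀ z ∈ Sᶜ, degIn D S z ≤ 3 := by
    intro z hz
    rw [mem_compl, hS, mem_union, mem_union, not_or, not_or] at hz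
    have h := hsplit z
    have := hone₁ z hz.1.1
    have := hone₂ z hz.1.2
    have := hone₃ z hz.2
    omega
  -- `Q` and the triangle sums
  have hQ : adjPairs D S = ∑ x ∈ T₁, degIn D S x + ∑ x ∈ T₂, degIn D S x + ∑ x ∈ T₃, degIn D S x := by
    rw [adjPairs_eq_sum_degIn, hS, sum_union hd12, sum_union h12]
  have hQle : adjPairs D S ≤ 36 := by
    rw [adjPairs_eq_sum_degIn]
    calc ∑ x ∈ S, degIn D S x ≤ ∑ _x ∈ S, 4 := sum_le_sum hdeg4
      _ = 36 := by rw [sum_const, hScard, smul_eq_mul]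
  have hQge : 18 ≤ adjPairs D S := by
    rw [adjPairs_eq_sum_degIn]
    calc 18 = ∑ _x ∈ S, 2 := by rw [sum_const, hScard, smul_eq_mul]
      _ ≤ ∑ x ∈ S, degIn D S x := sum_le_sum hdeg2
  -- the pointwise bound off `S`: `4 W + 2 s² + 2 s d ≤ 18 s + 9 d + 12`
  have hpt : ∀ z ∈ Sᶜ, 4 * ∑ x ∈ S.filter (fun x => D.Adj z x), degIn D S x +
      2 * (degIn D S z * degIn D S z) + 2 * (degIn D S z * degIn D Sᶜ z) ≤
      18 * degIn D S z + 9 * degIn D Sᶜ z + 12 := by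
    intro z hz
    have hW := sum_degIn_le_four_mul D S hdeg4 z
    have hs := hout z hz
    set s := degIn D S z with hsdef
    clear_value s
    interval_cases s <;> omega
  have hptsum := sum_le_sum hpt
  rw [sum_add_distrib, sum_add_distrib, sum_add_distrib, sum_add_distrib, ← mul_sum, ← mul_sum, ← mul_sum,
    ← mul_sum, ← mul_sum, sum_const, smul_eq_mul] at hptsum
  rw [hScard] at hcount
  have hk' : Fintype.card V = Sᶜ.card + 9 := by omega
  rw [hk']
  set Q := adjPairs D S with hQdef
  set R := Sᶜ.card with hRdef
  set Def := ∑ p ∈ adjPairsAll D, deficit D p with hDef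
  clear_value Q R Def
  have hmain : R * Q + 180 ≤ Def + 4 * Q + 12 * R := by linarith
  have hR1 : 1 ≤ R := by omega
  rcases Nat.lt_or_ge R 4 with hR | hR
  · interval_cases R <;> omega
  · obtain ⟨r, hr⟩ : ∃ r, R = r + 4 := ⟨R - 4, by omega⟩
    subst hr
    have : 18 * r ≤ r * Q := by nlinarith
    nlinarith

/-- **AT MOST EIGHTEEN ORDERED TRIANGLES** when every triangle is one of `T₁, T₂, T₃` (three-cliques) and an edge
lies in at most one triangle. -/
theorem card_triangles3_le_eighteen_of_three (D : SimpleGraph V) [DecidableRel D.Adj] (T₁ T₂ T₃ : Finset V)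
    (h₁ : T₁.card = 3) (h₂ : T₂.card = 3) (h₃ : T₃.card = 3)
    (hcl₁ : ∀ x ∈ T₁, ∀ y ∈ T₁, x ≠ y → D.Adj x y) (hcl₂ : ∀ x ∈ T₂, ∀ y ∈ T₂, x ≠ y → D.Adj x y)
    (hcl₃ : ∀ x ∈ T₃, ∀ y ∈ T₃, x ≠ y → D.Adj x y)
    (hT : ∀ x y z, D.Adj x y → D.Adj x z → D.Adj y z →
      (x ∈ T₁ ∧ y ∈ T₁) ∨ (x ∈ T₂ ∧ y ∈ T₂) ∨ (x ∈ T₃ ∧ y ∈ T₃))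
    (hcodeg : ∀ x y z z', D.Adj x y → D.Adj x z → D.Adj y z → D.Adj x z' → D.Adj y z' → z = z') :
    (triangles3 D).card ≤ 18 := by
  have hP : ∀ (T : Finset V), T.card = 3 → (∀ x ∈ T, ∀ y ∈ T, x ≠ y → D.Adj x y) →
      ((T ×ˢ T).filter (fun p : V × V => D.Adj p.1 p.2)).card = 6 := by
    intro T hT hcl
    have := adjPairs_eq_sum_degIn D T
    unfold adjPairs at this
    rw [this, sum_congr rfl (fun x hx => degIn_self_of_clique D hT hcl hx), sum_const, hT, smul_eq_mul]
  set U : Finset (V × V) := (T₁ ×ˢ T₁).filter (fun p : V × V => D.Adj p.1 p.2) ∪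
    (T₂ ×ˢ T₂).filter (fun p : V × V => D.Adj p.1 p.2) ∪
    (T₃ ×ˢ T₃).filter (fun p : V × V => D.Adj p.1 p.2) with hU
  clear_value U
  have hmaps : Set.MapsTo (fun t : (V × V) × V => t.1) (triangles3 D : Set ((V × V) × V))
      (U : Set (V × V)) := by
    intro s hs
    rw [mem_coe, triangles3, mem_filter, mem_product, mem_adjPairsAll] at hs
    obtain ⟨⟨hxy, -⟩, hxz, hyz⟩ := hs
    rw [mem_coe, hU, mem_union, mem_union, mem_filter, mem_filter, mem_filter, mem_product, mem_product,
      mem_product]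
    rcases hT s.1.1 s.1.2 s.2 hxy hxz hyz with ⟨h1, h2⟩ | ⟨h1, h2⟩ | ⟨h1, h2⟩
    · exact Or.inl (Or.inl ⟨⟨h1, h2⟩, hxy⟩)
    · exact Or.inl (Or.inr ⟨⟨h1, h2⟩, hxy⟩)
    · exact Or.inr ⟨⟨h1, h2⟩, hxy⟩
  have hinj : Set.InjOn (fun t : (V × V) × V => t.1) (triangles3 D) := by
    intro s hs s' hs' h
    simp only at h
    rw [mem_coe, triangles3, mem_filter, mem_product, mem_adjPairsAll] at hs hs'
    obtain ⟨⟨hxy, -⟩, hxz, hyz⟩ := hs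
    obtain ⟨⟨-, -⟩, hxz', hyz'⟩ := hs'
    rw [← h] at hxz' hyz'
    have := hcodeg s.1.1 s.1.2 s.2 s'.2 hxy hxz hyz hxz' hyz'
    exact Prod.ext h this
  have := card_le_card_of_injOn _ hmaps hinj
  have hu1 := card_union_le ((T₁ ×ˢ T₁).filter (fun p : V × V => D.Adj p.1 p.2) ∪
    (T₂ ×ˢ T₂).filter (fun p : V × V => D.Adj p.1 p.2)) ((T₃ ×ˢ T₃).filter (fun p : V × V => D.Adj p.1 p.2))
  have hu2 := card_union_le ((T₁ ×ˢ T₁).filter (fun p : V × V => D.Adj p.1 p.2))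
    ((T₂ ×ˢ T₂).filter (fun p : V × V => D.Adj p.1 p.2))
  rw [← hU] at hu1
  have e1 := hP T₁ h₁ hcl₁
  have e2 := hP T₂ h₂ hcl₂
  have e3 := hP T₃ h₃ hcl₃
  omega

/-- **THE `r = 2` STABILITY FOR THREE VERTEX-DISJOINT TRIANGLES, `k ≥ 10`:** `K₄⁻`-free, every triangle one of the
three pairwise disjoint triangles `T₁, T₂, T₃` ⇒ `Σ_v d(v)² + 2 (k − 3) ≤ m k`. -/
theorem three_triangles_stability_two_of_disjoint (D : SimpleGraph V) [DecidableRel D.Adj] (hK : K4mFree D)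
    (hk : 10 ≤ Fintype.card V) (T₁ T₂ T₃ : Finset V) (h₁ : T₁.card = 3) (h₂ : T₂.card = 3) (h₃ : T₃.card = 3)
    (h12 : Disjoint T₁ T₂) (h13 : Disjoint T₁ T₃) (h23 : Disjoint T₂ T₃)
    (hcl₁ : ∀ x ∈ T₁, ∀ y ∈ T₁, x ≠ y → D.Adj x y) (hcl₂ : ∀ x ∈ T₂, ∀ y ∈ T₂, x ≠ y → D.Adj x y)
    (hcl₃ : ∀ x ∈ T₃, ∀ y ∈ T₃, x ≠ y → D.Adj x y)
    (hone₁ : ∀ z, z ∉ T₁ → degIn D T₁ z ≤ 1) (hone₂ : ∀ z, z ∉ T₂ → degIn D T₂ z ≤ 1)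
    (hone₃ : ∀ z, z ∉ T₃ → degIn D T₃ z ≤ 1)
    (hT : ∀ x y z, D.Adj x y → D.Adj x z → D.Adj y z →
      (x ∈ T₁ ∧ y ∈ T₁) ∨ (x ∈ T₂ ∧ y ∈ T₂) ∨ (x ∈ T₃ ∧ y ∈ T₃)) :
    ∑ v, deg D v * deg D v + 2 * (Fintype.card V - 3) ≤ D.edgeFinset.card * Fintype.card V := by
  have hdef := four_mul_card_add_six_le_sum_deficit_of_three_disjoint D T₁ T₂ T₃ h₁ h₂ h₃ h12 h13 h23
    hcl₁ hcl₂ hcl₃ hone₁ hone₂ hone₃ hk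
  have h18 := card_triangles3_le_eighteen_of_three D T₁ T₂ T₃ h₁ h₂ h₃ hcl₁ hcl₂ hcl₃ hT
    (fun x y z z' hxy hxz hyz hxz' hyz' => eq_of_common_nbr D hK hxy hxz hyz hxz' hyz')
  have hid := two_mul_sum_deg_sq_add_sum_deficit D
  have hmk : 2 * (D.edgeFinset.card * Fintype.card V) = 2 * D.edgeFinset.card * Fintype.card V := by ring
  omega

end C047

end TriangleCap

end PercRepro
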